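import Summits.Ventures.YMGap.YM4Door.OpenDoor

/-!
# YM4Door / Crossover — CAUCHY IN LOADS ⇒ U-CV with a finite-depth reference (`blockClusters_from_depth`); THE CROSSOVER OPERATOR
# (`IsCrossoverImage`, `BlockIRVia`, `blockIRVia_comp`), N-NP `CrossoverContinuousAt` (EXISTENTIAL in the exit representation) and its glue
# `blockIR_forall_of_crossover`; the D-0037 volume-uniform form `blockIR_uniform_of_crossover`; the `1/3`-cell instances

HONEST FRAMING (cell `ym-beyond`, seat P2 «strong-coupling bridge», HUMAN RULING D-0035 / D-0037; g8 tree edition, 2026-08-25, split into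
≤ 400-line modules for the gate; memo `HOME/ROUTE-P2.md` v0.8, spec `HOME/ROUTE-P2-LIFT-SPEC.md` v2).  LATTICE / finite-torus bookkeeping only:
nothing here is a continuum, spectral or Clay-sense statement; nothing here moves the weak-coupling exit of Track A (uncertified); nothing
here is a part of Bałaban's theorems; NO effective action is asserted to be at any door.  NO conjecture name, NO `sorry`, NO axiom beyond
the standard three; label K = kernel bookkeeping.

Continuation of `YM4Door/OpenDoor.lean` (its header is the reference; §2–§5 of the one text).  N-NP and N-CVg are REQUESTS to leg 1
(typed hypotheses), not claims; the only discharged membership is pure Wilson at tree coupling `1/12` in the certified `1/3` cell.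
References: as there; L. Bertini, E. Cirillo, E. Olivieri, J. Stat. Phys. 97 (1999) 831; memo `HOME/ROUTE-P2.md` §2.7, §4f.
-/

noncomputable section

open MeasureTheory Finset Function Metric
open scoped Matrix.Norms.Frobenius
open Literature.Probability.LatticeModels Literature.Probability.LatticeModels.DobrushinMetric
open Literature.MathematicalPhysics.QuantumLattice hiding torusNorm configShift
open Literature.MathematicalPhysics.QuantumFieldTheory hiding ZdEdge
open Summit.Ventures.YMGap.RobustBall
open Summit.Ventures.YMGap.StarResolventDim (Delta gaugeR doorPoly)
open Summit.Ventures.YMGap.YM3IR.ReceiverWitness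

namespace Summit.Ventures.YMGap.YM4Door

variable {d L N : ℕ} [NeZero L]

/-! ## §2  CAUCHY IN LOADS ⇒ CLOSE IN LOADS — the convergence axis of THE NUMBER

The index is the DEPTH `K` (number of renormalisation steps from the bare lattice `ε = L^{−K}` to the unit block scale;
equivalently the bare coupling `g₀(K)` of the tuned sequence).  U-CV (`CloseInLoads` about one reference) follows from a
CAUCHY condition on consecutive exit actions with summable tolerances — the action-level (format-norm) shadow of
«convergence, not only stability, of the effective actions as the cutoff is removed» (in print only for `U(1)`: Gross 1983,
Driver 1987) — and the reference is then the exit action at a finite depth `K₀` itself: no limit object is needed. -/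

section Cauchy

variable {S : ℕ} [NeZero S]

/-- **CAUCHY IN LOADS.**  Consecutive exit actions `𝓔 K`, `𝓔 (K+1)` have effective couplings within `σc K` and term
families differing by a perturbation of loads `≤ (σ₀ K, σ₁ K)` at rate `κ`. -/
@[folklore] def CauchyInLoads (𝓔 : ℕ → BalabanEffectiveAction 4 S (SUN 2) 1) (κ : ℝ) (σc σ₀ σ₁ : ℕ → ℝ) : Prop :=
  ∀ K, |(𝓔 (K + 1)).β - (𝓔 K).β| ≤ σc K ∧
    ∃ V : Perturbation 4 S 2, (𝓔 (K + 1)).terms = (𝓔 K).terms + V ∧ InBall κ (σ₀ K) (σ₁ K) V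

variable {𝓔 : ℕ → BalabanEffectiveAction 4 S (SUN 2) 1} {κ : ℝ} {σc σ₀ σ₁ : ℕ → ℝ}

/-- Telescoping: depth `K₀ + n` against depth `K₀`, tolerances the partial sums (induction on `n`; loads add by the tree's
`inBall_add`). -/
theorem CauchyInLoads.partial (h : CauchyInLoads 𝓔 κ σc σ₀ σ₁) (K₀ : ℕ) : ∀ n : ℕ,
    |(𝓔 (K₀ + n)).β - (𝓔 K₀).β| ≤ ∑ l ∈ range n, σc (K₀ + l) ∧
      ∃ V : Perturbation 4 S 2, (𝓔 (K₀ + n)).terms = (𝓔 K₀).terms + V ∧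
        InBall κ (∑ l ∈ range n, σ₀ (K₀ + l)) (∑ l ∈ range n, σ₁ (K₀ + l)) V
  | 0 => by
      refine ⟨by simp, 0, ?_, ?_⟩
      · ext X U
        simp
      · simp only [sum_range_zero]
        exact zero_mem_clusterDomain le_rfl le_rfl
  | n + 1 => by
      obtain ⟨hβ, V, hV, hVB⟩ := CauchyInLoads.partial h K₀ n
      obtain ⟨hc, V', hV', hV'B⟩ := h (K₀ + n)
      have eK : K₀ + (n + 1) = K₀ + n + 1 := rfl
      refine ⟨?_, V + V', ?_, ?_⟩
      · rw [sum_range_succ, eK]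
        have e : (𝓔 (K₀ + n + 1)).β - (𝓔 K₀).β =
            ((𝓔 (K₀ + n + 1)).β - (𝓔 (K₀ + n)).β) + ((𝓔 (K₀ + n)).β - (𝓔 K₀).β) := by ring
        rw [e]
        calc |(𝓔 (K₀ + n + 1)).β - (𝓔 (K₀ + n)).β + ((𝓔 (K₀ + n)).β - (𝓔 K₀).β)|
            ≤ |(𝓔 (K₀ + n + 1)).β - (𝓔 (K₀ + n)).β| + |(𝓔 (K₀ + n)).β - (𝓔 K₀).β| := abs_add_le _ _
          _ ≤ σc (K₀ + n) + ∑ l ∈ range n, σc (K₀ + l) := add_le_add hc hβ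
          _ = ∑ l ∈ range n, σc (K₀ + l) + σc (K₀ + n) := add_comm _ _
      · rw [eK, hV', hV]
        ext X U
        simp only [QuasiLocalGaugePerturbation.add_act, add_assoc]
      · rw [sum_range_succ, sum_range_succ]
        exact inBall_add hVB hV'B

/-- ★ **CAUCHY IN LOADS ⇒ CLOSE IN LOADS from depth `K₀` on**, about the exit action AT DEPTH `K₀`, with any uniform
bounds `(Tc; T₀, T₁)` of the partial sums of the tolerances from `K₀`. -/
theorem closeInLoads_of_cauchyInLoads (h : CauchyInLoads 𝓔 κ σc σ₀ σ₁) (K₀ : ℕ) {Tc T₀ T₁ : ℝ}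
    (hc : ∀ n, ∑ l ∈ range n, σc (K₀ + l) ≤ Tc) (h₀ : ∀ n, ∑ l ∈ range n, σ₀ (K₀ + l) ≤ T₀)
    (h₁ : ∀ n, ∑ l ∈ range n, σ₁ (K₀ + l) ≤ T₁) :
    CloseInLoads (fun n : ℕ => 𝓔 (K₀ + n)) (𝓔 K₀).β (𝓔 K₀).terms Tc κ T₀ T₁ := by
  intro n
  obtain ⟨hβ, V, hV, hVB⟩ := h.partial K₀ n
  exact ⟨hβ.trans (hc n), V, hV, inBall_mono hVB (h₀ n) (h₁ n)⟩

/-- Geometric majorants: `σ l ≤ C θ^l` (`C ≥ 0`, `0 ≤ θ < 1`) ⇒ every partial sum from `K₀` is `≤ C θ^{K₀}/(1 − θ)`. -/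
theorem sum_range_shift_le_of_geometric {σ : ℕ → ℝ} {C θ : ℝ} (hC : 0 ≤ C) (hθ0 : 0 ≤ θ) (hθ1 : θ < 1)
    (hσ : ∀ l, σ l ≤ C * θ ^ l) (K₀ n : ℕ) : ∑ l ∈ range n, σ (K₀ + l) ≤ C * θ ^ K₀ / (1 - θ) := by
  have h1 : 0 < 1 - θ := sub_pos.2 hθ1
  have hgeom : ∑ l ∈ range n, θ ^ l ≤ 1 / (1 - θ) := by
    rw [le_div_iff₀ h1]
    have hs : (∑ l ∈ range n, θ ^ l) * (1 - θ) = 1 - θ ^ n := by rw [mul_comm]; exact mul_neg_geom_sum θ n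
    rw [hs]
    linarith [pow_nonneg hθ0 n]
  calc ∑ l ∈ range n, σ (K₀ + l) ≤ ∑ l ∈ range n, C * θ ^ K₀ * θ ^ l :=
        sum_le_sum fun l _ => by rw [mul_assoc, ← pow_add]; exact hσ (K₀ + l)
    _ = C * θ ^ K₀ * ∑ l ∈ range n, θ ^ l := by rw [mul_sum]
    _ ≤ C * θ ^ K₀ * (1 / (1 - θ)) := by
        exact mul_le_mul_of_nonneg_left hgeom (mul_nonneg hC (pow_nonneg hθ0 _))
    _ = C * θ ^ K₀ / (1 - θ) := by ring

/-- ★ **CLOSE IN LOADS WITH GEOMETRIC TAILS.**  Cauchy-in-loads with geometric tolerances `Cc θ^K`, `C₀ θ^K`, `C₁ θ^K`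
⇒ from every depth `K₀` the family is close in loads to `𝓔 K₀` with tolerances the tails `C· θ^{K₀}/(1 − θ)`. -/
theorem closeInLoads_of_cauchyInLoads_geometric (h : CauchyInLoads 𝓔 κ σc σ₀ σ₁) {Cc C₀ C₁ θ : ℝ} (hCc : 0 ≤ Cc)
    (hC₀ : 0 ≤ C₀) (hC₁ : 0 ≤ C₁) (hθ0 : 0 ≤ θ) (hθ1 : θ < 1) (hσc : ∀ K, σc K ≤ Cc * θ ^ K)
    (hσ₀ : ∀ K, σ₀ K ≤ C₀ * θ ^ K) (hσ₁ : ∀ K, σ₁ K ≤ C₁ * θ ^ K) (K₀ : ℕ) :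
    CloseInLoads (fun n : ℕ => 𝓔 (K₀ + n)) (𝓔 K₀).β (𝓔 K₀).terms (Cc * θ ^ K₀ / (1 - θ)) κ
      (C₀ * θ ^ K₀ / (1 - θ)) (C₁ * θ ^ K₀ / (1 - θ)) :=
  closeInLoads_of_cauchyInLoads h K₀ (sum_range_shift_le_of_geometric hCc hθ0 hθ1 hσc K₀)
    (sum_range_shift_le_of_geometric hC₀ hθ0 hθ1 hσ₀ K₀) (sum_range_shift_le_of_geometric hC₁ hθ0 hθ1 hσ₁ K₀)

/-- **The depth threshold.**  `K₀ ≥ log(C/(τ(1−θ))) / log(1/θ)` makes the geometric tail `C θ^{K₀}/(1 − θ) ≤ τ`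
(`C, τ > 0`, `0 < θ < 1`): the number of EXTRA renormalisation steps that buys a given load tolerance. -/
theorem geometric_tail_le {C θ τ : ℝ} (hC : 0 < C) (hθ0 : 0 < θ) (hθ1 : θ < 1) (hτ : 0 < τ) {K₀ : ℕ}
    (hk : Real.log (C / (τ * (1 - θ))) / Real.log (1 / θ) ≤ K₀) : C * θ ^ K₀ / (1 - θ) ≤ τ := by
  have h1 : 0 < 1 - θ := sub_pos.2 hθ1
  have hlog : 0 < Real.log (1 / θ) := Real.log_pos ((one_lt_div hθ0).2 hθ1)
  have hk' : Real.log (C / (τ * (1 - θ))) ≤ (K₀ : ℝ) * Real.log (1 / θ) := (div_le_iff₀ hlog).1 hk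
  rw [one_div, Real.log_inv, Real.log_div hC.ne' (mul_pos hτ h1).ne'] at hk'
  have hpos : 0 < τ * (1 - θ) / C := by positivity
  have key : θ ^ K₀ ≤ τ * (1 - θ) / C := by
    rw [← Real.exp_log (pow_pos hθ0 K₀), ← Real.exp_log hpos, Real.exp_le_exp, Real.log_pow,
      Real.log_div (mul_pos hτ h1).ne' hC.ne']
    linarith
  rw [div_le_iff₀ h1]
  calc C * θ ^ K₀ ≤ C * (τ * (1 - θ) / C) := mul_le_mul_of_nonneg_left key hC.le
    _ = τ * (1 - θ) := by field_simp

/-- ★ **BLOCK-LEVEL IR AT EVERY DEPTH `≥ K₀` FROM CAUCHY-IN-LOADS.**  An open door; the exit action at depth `K₀` in Gibbs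
form and IN THE CORE; Cauchy-in-loads with partial sums from `K₀` inside the margins `(τc; τ₀, τ₁)`; every exit action in
Gibbs form for its blocking `B K` and bare coupling `βbare K` ⇒ `BlockClusters (B (K₀+n)) (βbare (K₀+n)) A m` for EVERY `n`. -/
theorem blockClusters_from_depth {A m τc τ₀ τ₁ : ℝ} (D : OpenDoor S A m κ τc τ₀ τ₁) (h : CauchyInLoads 𝓔 κ σc σ₀ σ₁)
    (K₀ : ℕ) (hc : ∀ n, ∑ l ∈ range n, σc (K₀ + l) ≤ τc) (h₀ : ∀ n, ∑ l ∈ range n, σ₀ (K₀ + l) ≤ τ₀)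
    (h₁ : ∀ n, ∑ l ∈ range n, σ₁ (K₀ + l) ≤ τ₁) (hcore : ((𝓔 K₀).β, (𝓔 K₀).terms) ∈ D.core)
    {bOf : ℕ → ℕ} [∀ K, NeZero (bOf K)] (B : ∀ K, GaugeBlockAveraging 4 (SUN 2) (bOf K) S) (βbare : ℕ → ℝ)
    (hGibbs : ∀ K, IsBalabanEffectiveActionOf SU2.ρ2 (B K) (βbare K) (𝓔 K)) (n : ℕ) :
    SU2.BlockClusters (B (K₀ + n)) (βbare (K₀ + n)) A m :=
  D.blockClusters_forall (fun n => B (K₀ + n)) (fun n => βbare (K₀ + n)) (fun n => 𝓔 (K₀ + n))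
    (fun n => hGibbs (K₀ + n)) hcore (closeInLoads_of_cauchyInLoads h K₀ hc h₀ h₁) n

end Cauchy

/-! ## §3  THE CROSSOVER OPERATOR — H-a factorised by scale

All but a β-free number `K` of renormalisation steps run at SMALL running coupling.  Put the convergence statement where
Track A's currency lives — at the last perturbative scale `g` (torus of side `bK·S` in scale-`g` units, `bK = L^K`) — and
ask of the remaining `K` steps `BK` only CONTINUITY AT ONE POINT from strip currency to load currency.  The `K`-step map is
not a function on `BalabanEffectiveAction` (polymer representations of one density are not unique), so N-NP is typed
EXISTENTIALLY in the exit representation and tied to the renormalisation group through `IsBlockingOf`. -/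

section Crossover

/-- **`y` is a CROSSOVER IMAGE of `x` under the `K` remaining steps `BK`**: blocking the Gibbs weight `e^{−x(U)} dU` of the
scale-`g` action `x` (torus `bK·S`) through `BK` gives the weight `e^{−y(V)} dV` of the exit action `y` (torus `S`) —
Bałaban's `ρ_{k+K} = T^K ρ_k` (CMP 119 (1988) (0.1)) for the composite averaging, in the tree's `IsBlockingOf`. -/
@[folklore] def IsCrossoverImage {bK S : ℕ} [NeZero bK] [NeZero S] (BK : GaugeBlockAveraging 4 (SUN 2) bK S)
    (x : BalabanEffectiveAction 4 (bK * S) (SUN 2) 1) (y : BalabanEffectiveAction 4 S (SUN 2) 1) : Prop :=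
  BK.IsBlockingOf (x.density SU2.ρ2) (y.density SU2.ρ2)

/-- **BLOCK-LEVEL IR VIA A LINK MAP `Φ`** (fine torus `n` → block torus `S`): the fine Wilson law at `β`, pushed forward
along `Φ`, is the Gibbs law of SOME Bałaban-format action clustering at `(A, m)`.  For `Φ = B.link` this is g4's
`SU2.BlockClusters B` (`SU2.blockClusters_iff_via`); it is the form that composes (`blockIRVia_comp`). -/
@[folklore] def BlockIRVia {n S : ℕ} [NeZero n] [NeZero S] (Φ : GaugeConfig 4 n (SUN 2) → GaugeConfig 4 S (SUN 2)) (β A m : ℝ) :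
    Prop :=
  ∃ 𝓔 : BalabanEffectiveAction 4 S (SUN 2) 1,
    ((torusLinkHaar 4 (SUN 2) n).withDensity (perturbedWilsonDensity SU2.ρ2 β 0)).map Φ =
        (torusLinkHaar 4 (SUN 2) S).withDensity (𝓔.density SU2.ρ2) ∧
      ClustersWith 𝓔.terms 𝓔.β A m

/-- g4's `BlockClusters B` IS `BlockIRVia B.link` (definitional unfolding of `IsBalabanEffectiveActionOf`). -/
theorem SU2.blockClusters_iff_via {b S : ℕ} [NeZero b] [NeZero S] (B : GaugeBlockAveraging 4 (SUN 2) b S) (β A m : ℝ) :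
    SU2.BlockClusters B β A m ↔ BlockIRVia B.link β A m :=
  Iff.rfl

/-- **Gibbs form composes through a crossover image.**  `x` the effective action of fine Yang–Mills at `β` under the
blocking `Bg` (to the scale-`g` torus `bK·S`) and `y` a crossover image of `x` under `BK` ⇒ the fine Wilson law pushed along
the COMPOSITE link map `BK.link ∘ Bg.link` is the Gibbs law of `y` (`Measure.map_map`). -/
theorem map_comp_of_isCrossoverImage {b₁ bK S : ℕ} [NeZero b₁] [NeZero bK] [NeZero S]
    (Bg : GaugeBlockAveraging 4 (SUN 2) b₁ (bK * S)) (BK : GaugeBlockAveraging 4 (SUN 2) bK S) {β : ℝ}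
    {x : BalabanEffectiveAction 4 (bK * S) (SUN 2) 1} {y : BalabanEffectiveAction 4 S (SUN 2) 1}
    (hx : IsBalabanEffectiveActionOf SU2.ρ2 Bg β x) (hy : IsCrossoverImage BK x y) :
    ((torusLinkHaar 4 (SUN 2) (b₁ * (bK * S))).withDensity (perturbedWilsonDensity SU2.ρ2 β 0)).map
        (BK.link ∘ Bg.link) = (torusLinkHaar 4 (SUN 2) S).withDensity (y.density SU2.ρ2) := by
  rw [← Measure.map_map BK.measurable_link Bg.measurable_link]
  have hx' : ((torusLinkHaar 4 (SUN 2) (b₁ * (bK * S))).withDensity (perturbedWilsonDensity SU2.ρ2 β 0)).map Bg.link =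
      (torusLinkHaar 4 (SUN 2) (bK * S)).withDensity (x.density SU2.ρ2) := hx
  rw [hx']
  exact hy

/-- **… hence block-level IR composes**: scale-`g` Gibbs form ∧ crossover image ∧ the image clusters ⇒ `BlockIRVia` for the
composite link map. -/
theorem blockIRVia_comp {b₁ bK S : ℕ} [NeZero b₁] [NeZero bK] [NeZero S]
    (Bg : GaugeBlockAveraging 4 (SUN 2) b₁ (bK * S)) (BK : GaugeBlockAveraging 4 (SUN 2) bK S) {β A m : ℝ}
    {x : BalabanEffectiveAction 4 (bK * S) (SUN 2) 1} {y : BalabanEffectiveAction 4 S (SUN 2) 1}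
    (hx : IsBalabanEffectiveActionOf SU2.ρ2 Bg β x) (hy : IsCrossoverImage BK x y) (hcl : ClustersWith y.terms y.β A m) :
    BlockIRVia (BK.link ∘ Bg.link) β A m :=
  ⟨y, map_comp_of_isCrossoverImage Bg BK hx hy, hcl⟩

/-- **N-CVg's currency — NEAR IN STRIP FORMAT at scale `g`.**  `x` is `(ηc; r, κ, η)`-near `ref` on the scale-`g` torus:
couplings within `ηc`, and `x.terms − ref.terms` of (2.42)-norm `≤ η` on the strip of width `r` at rate `κ`, thin supports
— Track A's own format (Bałaban CMP 119 (1988) p. 259 (ii),(iv), p. 261 (2.42)), the currency in which «convergence, not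
only stability, of the scale-`g` effective actions along the tuned sequence» (node N-CVg) would be delivered. -/
@[folklore] def NearInStrip {S' : ℕ} [NeZero S'] (x ref : BalabanEffectiveAction 4 S' (SUN 2) 1) (ηc r κ η : ℝ) : Prop :=
  |x.β - ref.β| ≤ ηc ∧ ∃ V : Perturbation 4 S' 2, x.terms = ref.terms + V ∧
    V.HasAnalyticNormLE SU2.ρ2 (fun _ => stripDomain SU2.ρ2 r) κ η ∧ ∀ X, V.act X ≠ 0 → (polymerDiam X : ℝ) ≤ (X.card : ℝ) - 1

/-- ★ **N-NP — THE CROSSOVER OPERATOR IS CONTINUOUS AT THE REFERENCE, strip currency → load currency.**  Every scale-`g`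
action `(ηc; r, κ, η)`-near `ref` HAS a crossover image under the `K` steps `BK` lying within `(τc; κb, τ₀, τ₁)` of the
reference exit action `yref` in LOAD currency.  EXISTENTIAL in the image: the universally quantified version («every
crossover image is close») is trivially false, a density having polymer representations of arbitrary loads.  `K = log_L bK`
is β-FREE (memo §2.7), so this is ONE continuity statement about finitely many non-perturbative renormalisation steps at
`O(1)` running coupling — its honest threat is non-Gibbsianness / large-field domination of renormalised measures
(van Enter–Fernández–Sokal 1993), its honest support that `K` is fixed and the reference is ONE action. -/
@[folklore] def CrossoverContinuousAt {bK S : ℕ} [NeZero bK] [NeZero S] (BK : GaugeBlockAveraging 4 (SUN 2) bK S)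
    (ref : BalabanEffectiveAction 4 (bK * S) (SUN 2) 1) (yref : BalabanEffectiveAction 4 S (SUN 2) 1)
    (ηc r κ η τc κb τ₀ τ₁ : ℝ) : Prop :=
  ∀ x : BalabanEffectiveAction 4 (bK * S) (SUN 2) 1, NearInStrip x ref ηc r κ η →
    ∃ y : BalabanEffectiveAction 4 S (SUN 2) 1, IsCrossoverImage BK x y ∧ |y.β - yref.β| ≤ τc ∧
      ∃ V : Perturbation 4 S 2, y.terms = yref.terms + V ∧ InBall κb τ₀ τ₁ V

/-- ★ **H-a FACTORISED: block-level IR for EVERY index from N-CVg ∧ N-NP ∧ an open door.**  Block torus `S`; the `K`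
remaining steps `BK`; an open door `D` with the reference exit `yref` in its core; N-NP at `(ref ↦ yref)` with the door's
margins; a family `x i` of scale-`g` actions (index `i`: bare coupling / depth), each the effective action of fine
Yang–Mills at `βbare i` under its blocking `Bg i`, and each near `ref` in strip currency (N-CVg, «eventually» absorbed in
the index set) ⇒ for EVERY `i` the fine Wilson law blocked along the composite map clusters at the door's `(A, m)`. -/
theorem blockIR_forall_of_crossover {bK S : ℕ} [NeZero bK] [NeZero S] {A m κb τc τ₀ τ₁ : ℝ}
    (D : OpenDoor S A m κb τc τ₀ τ₁) (BK : GaugeBlockAveraging 4 (SUN 2) bK S)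
    {ref : BalabanEffectiveAction 4 (bK * S) (SUN 2) 1} {yref : BalabanEffectiveAction 4 S (SUN 2) 1}
    (href : (yref.β, yref.terms) ∈ D.core) {ηc r κ η : ℝ}
    (hNP : CrossoverContinuousAt BK ref yref ηc r κ η τc κb τ₀ τ₁)
    {ι : Type*} (x : ι → BalabanEffectiveAction 4 (bK * S) (SUN 2) 1) (hCV : ∀ i, NearInStrip (x i) ref ηc r κ η)
    {b₁ : ι → ℕ} [∀ i, NeZero (b₁ i)] (Bg : ∀ i, GaugeBlockAveraging 4 (SUN 2) (b₁ i) (bK * S)) (βbare : ι → ℝ)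
    (hGibbs : ∀ i, IsBalabanEffectiveActionOf SU2.ρ2 (Bg i) (βbare i) (x i)) (i : ι) :
    BlockIRVia (BK.link ∘ (Bg i).link) (βbare i) A m := by
  obtain ⟨y, hy, hc, V, hV, hVB⟩ := hNP (x i) (hCV i)
  refine blockIRVia_comp (Bg i) BK (hGibbs i) hy ?_
  have hmem := D.isOpen yref.β yref.terms href (y.β - yref.β) V hc hVB
  have h := D.clusters _ _ hmem
  have e : yref.β + (y.β - yref.β) = y.β := by ring
  rw [e, ← hV] at h
  exact h

/-- **N-NP ∧ N-CVg ⇒ U-CV** (the g6 interface): the chosen crossover images form a family `CloseInLoads` about the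
reference exit — so every g6 consumer (`OpenDoor.clustersWith_forall`, the window door `OpenDoor.ofDS`) applies verbatim. -/
theorem closeInLoads_of_crossover {bK S : ℕ} [NeZero bK] [NeZero S] (BK : GaugeBlockAveraging 4 (SUN 2) bK S)
    {ref : BalabanEffectiveAction 4 (bK * S) (SUN 2) 1} {yref : BalabanEffectiveAction 4 S (SUN 2) 1}
    {ηc r κ η τc κb τ₀ τ₁ : ℝ} (hNP : CrossoverContinuousAt BK ref yref ηc r κ η τc κb τ₀ τ₁)
    {ι : Type*} (x : ι → BalabanEffectiveAction 4 (bK * S) (SUN 2) 1) (hCV : ∀ i, NearInStrip (x i) ref ηc r κ η) :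
    ∃ y : ι → BalabanEffectiveAction 4 S (SUN 2) 1, (∀ i, IsCrossoverImage BK (x i) (y i)) ∧
      CloseInLoads y yref.β yref.terms τc κb τ₀ τ₁ := by
  choose y hy hc hV using fun i => hNP (x i) (hCV i)
  exact ⟨y, hy, fun i => ⟨hc i, hV i⟩⟩

end Crossover

/-! ## §4  THE VOLUME-UNIFORM FORM (D-0037: a per-torus clustering statement is vacuous)

Every constant below — the door's `(A, m)`, its margins `(τc; κb, τ₀, τ₁)`, the strip tolerances `(ηc; r, κ, η)`, the number
of crossover steps `bK = L^K` — is FREE OF THE BLOCK-TORUS SIZE `S`; only the reference actions and the blockings depend on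
`S`.  This is the only form in which block-level clustering feeds a thermodynamic-limit / mass-gap consumer. -/

section Uniform

/-- ★ **VOLUME-UNIFORM BLOCK-LEVEL IR FROM THE FACTORISED H-a.**  For every block torus `S ≥ 3`: an open door with
`S`-free constants, a reference exit in its core, N-NP and N-CVg with `S`-free tolerances, scale-`g` Gibbs form ⇒
`BlockIRVia` at `(A, m)` for every `S ≥ 3` and every index. -/
theorem blockIR_uniform_of_crossover {bK : ℕ} [NeZero bK] {A m κb τc τ₀ τ₁ ηc r κ η : ℝ}
    (D : ∀ (S : ℕ) [NeZero S], 3 ≤ S → OpenDoor S A m κb τc τ₀ τ₁)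
    (BK : ∀ (S : ℕ) [NeZero S], GaugeBlockAveraging 4 (SUN 2) bK S)
    (ref : ∀ (S : ℕ) [NeZero S], BalabanEffectiveAction 4 (bK * S) (SUN 2) 1)
    (yref : ∀ (S : ℕ) [NeZero S], BalabanEffectiveAction 4 S (SUN 2) 1)
    (href : ∀ (S : ℕ) [NeZero S] (hS : 3 ≤ S), ((yref S).β, (yref S).terms) ∈ (D S hS).core)
    (hNP : ∀ (S : ℕ) [NeZero S], 3 ≤ S → CrossoverContinuousAt (BK S) (ref S) (yref S) ηc r κ η τc κb τ₀ τ₁)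
    {ι : Type*} (x : ∀ (S : ℕ) [NeZero S], ι → BalabanEffectiveAction 4 (bK * S) (SUN 2) 1)
    (hCV : ∀ (S : ℕ) [NeZero S], 3 ≤ S → ∀ i, NearInStrip (x S i) (ref S) ηc r κ η)
    {b₁ : ι → ℕ} [∀ i, NeZero (b₁ i)]
    (Bg : ∀ (S : ℕ) [NeZero S] (i : ι), GaugeBlockAveraging 4 (SUN 2) (b₁ i) (bK * S)) (βbare : ι → ℝ)
    (hGibbs : ∀ (S : ℕ) [NeZero S] (i : ι), IsBalabanEffectiveActionOf SU2.ρ2 (Bg S i) (βbare i) (x S i))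
    (S : ℕ) [NeZero S] (hS : 3 ≤ S) (i : ι) : BlockIRVia ((BK S).link ∘ (Bg S i).link) (βbare i) A m :=
  blockIR_forall_of_crossover (D S hS) (BK S) (href S hS) (hNP S hS) (x S) (hCV S hS) (Bg S) βbare (hGibbs S) i

end Uniform

/-! ## §5  `SU(2)` instances on the certified `1/3` cell -/

section Third

/-- ★ **The `1/3` cell, reference exit FREE in the core.**  Margins `(τc; τ₀, τ₁)`; for every `S ≥ 3` a reference exit
`yref S` with coupling in `[τc, 1/6 − τc]` (tree units: inside the cell `β_W,eff ∈ [0, 1/3]` with `τc` to spare) and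
terms of loads `≤ (11/500 − τ₀, 11/1000 − τ₁)` at rate `1/100`; N-NP into these margins; N-CVg ⇒ volume-uniform
block-level IR at `(16 e^{1/50}, 1/100)`. -/
theorem blockIR_uniform_third {bK : ℕ} [NeZero bK] {τc τ₀ τ₁ ηc r κ η : ℝ}
    (BK : ∀ (S : ℕ) [NeZero S], GaugeBlockAveraging 4 (SUN 2) bK S)
    (ref : ∀ (S : ℕ) [NeZero S], BalabanEffectiveAction 4 (bK * S) (SUN 2) 1)
    (yref : ∀ (S : ℕ) [NeZero S], BalabanEffectiveAction 4 S (SUN 2) 1)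
    (hyc : ∀ (S : ℕ) [NeZero S], 3 ≤ S → τc ≤ (yref S).β ∧ (yref S).β ≤ 1 / 6 - τc)
    (hyt : ∀ (S : ℕ) [NeZero S], 3 ≤ S → InBall (1 / 100) (11 / 500 - τ₀) (11 / 1000 - τ₁) (yref S).terms)
    (hNP : ∀ (S : ℕ) [NeZero S], 3 ≤ S → CrossoverContinuousAt (BK S) (ref S) (yref S) ηc r κ η τc (1 / 100) τ₀ τ₁)
    {ι : Type*} (x : ∀ (S : ℕ) [NeZero S], ι → BalabanEffectiveAction 4 (bK * S) (SUN 2) 1)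
    (hCV : ∀ (S : ℕ) [NeZero S], 3 ≤ S → ∀ i, NearInStrip (x S i) (ref S) ηc r κ η)
    {b₁ : ι → ℕ} [∀ i, NeZero (b₁ i)]
    (Bg : ∀ (S : ℕ) [NeZero S] (i : ι), GaugeBlockAveraging 4 (SUN 2) (b₁ i) (bK * S)) (βbare : ι → ℝ)
    (hGibbs : ∀ (S : ℕ) [NeZero S] (i : ι), IsBalabanEffectiveActionOf SU2.ρ2 (Bg S i) (βbare i) (x S i))
    (S : ℕ) [NeZero S] (hS : 3 ≤ S) (i : ι) :
    BlockIRVia ((BK S).link ∘ (Bg S i).link) (βbare i) (16 * Real.exp (1 / 50)) (1 / 100) := by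
  refine blockIR_uniform_of_crossover (fun S _ hS => OpenDoor.ofDoorCell doorCell_oneThird hS le_rfl τc τ₀ τ₁) BK ref yref
    (fun S _ hS => ?_) hNP x hCV Bg βbare hGibbs S hS i
  exact ⟨(hyc S hS).1, (hyc S hS).2, hyt S hS⟩

/-- ★ **The `1/3` cell, reference exit = PURE WILSON at tree `β = 1/12` (`β_W,eff = 1/6`, the middle of the cell), zero
terms.**  N-NP with margins `τc ≤ 1/12`, `τ₀ ≤ 11/500`, `τ₁ ≤ 11/1000` at rate `1/100`; N-CVg
⇒ volume-uniform block-level IR at `(16 e^{1/50}, 1/100)`.  (A numeric instance; the honest reference exit is whatever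
the `K`-step image of the limiting scale-`g` action is — `blockIR_uniform_third`.) -/
theorem blockIR_uniform_third_wilson {bK : ℕ} [NeZero bK] {τc τ₀ τ₁ ηc r κ η : ℝ} (hτc : τc ≤ 1 / 12) (hτ₀ : τ₀ ≤ 11 / 500) (hτ₁ : τ₁ ≤ 11 / 1000)
    (BK : ∀ (S : ℕ) [NeZero S], GaugeBlockAveraging 4 (SUN 2) bK S)
    (ref : ∀ (S : ℕ) [NeZero S], BalabanEffectiveAction 4 (bK * S) (SUN 2) 1)
    (hNP : ∀ (S : ℕ) [NeZero S], 3 ≤ S → CrossoverContinuousAt (BK S) (ref S)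
      (BalabanEffectiveAction.wilsonAt (d := 4) (S := S) (G := SUN 2) (c := 1) (1 / 12)) ηc r κ η τc (1 / 100) τ₀ τ₁)
    {ι : Type*} (x : ∀ (S : ℕ) [NeZero S], ι → BalabanEffectiveAction 4 (bK * S) (SUN 2) 1)
    (hCV : ∀ (S : ℕ) [NeZero S], 3 ≤ S → ∀ i, NearInStrip (x S i) (ref S) ηc r κ η)
    {b₁ : ι → ℕ} [∀ i, NeZero (b₁ i)]
    (Bg : ∀ (S : ℕ) [NeZero S] (i : ι), GaugeBlockAveraging 4 (SUN 2) (b₁ i) (bK * S)) (βbare : ι → ℝ)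
    (hGibbs : ∀ (S : ℕ) [NeZero S] (i : ι), IsBalabanEffectiveActionOf SU2.ρ2 (Bg S i) (βbare i) (x S i))
    (S : ℕ) [NeZero S] (hS : 3 ≤ S) (i : ι) :
    BlockIRVia ((BK S).link ∘ (Bg S i).link) (βbare i) (16 * Real.exp (1 / 50)) (1 / 100) := by
  refine blockIR_uniform_third BK ref (fun S _ => BalabanEffectiveAction.wilsonAt (1 / 12)) (fun S _ _ => ?_)
    (fun S _ _ => ?_) hNP x hCV Bg βbare hGibbs S hS i
  · show τc ≤ 1 / 12 ∧ (1 / 12 : ℝ) ≤ 1 / 6 - τc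
    exact ⟨hτc, by linarith⟩
  · show InBall (1 / 100) (11 / 500 - τ₀) (11 / 1000 - τ₁) (0 : Perturbation 4 S 2)
    exact zero_mem_clusterDomain (by linarith) (by linarith)

end Third

end Summit.Ventures.YMGap.YM4Door

end
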